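import Summits.QuantumFields.QCD.Theses.SpectralDefectExtinction
import Summits.QuantumFields.QCD.Theorems.ExtinctionBuildsQCD.Negative.WithoutTightCollapse
import Summits.QuantumFields.QCD.Theorems.WindowExtinction.Negative.SpectralFlowLocal
import Literature.MathematicalPhysics.QuantumFieldTheory.SpectralDefectDensity
import Literature.Barriers.QuantumFields.WilsonDeterminantSign

/-!
# Kato line of crux `WindowExtinction` (stmt-QuantumFields-8964): the clause-(b)-joins-clause-(a) identity

Helper of the line `kato-radius-collective-defects` (planner skeleton `Cruxes/WindowExtinction/Lines/kato-radius-collective-defects.lean`,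
where these three lemmas are proved verbatim; landed unchanged by the chessboard line's lead, second seat c1, so that the
kato composition can import them): if `Γ₅ D_W(U,μ,1) φ = e φ` then `Re⟨φ, D_W(U,0,1)φ⟩ ≤ (−μ + |e|)‖φ‖²`, i.e. a coercivity
defect of the crux (clause (b)) is a sub-edge vector with Wilson-energy budget `−μ + |e|`, to which the collectivity lever
`stub_katoBudgetRadius` applies exactly as to a real mode (clause (a)).  Pure linear algebra (`Γ₅² = 1`, `Γ₅` Hermitian,
Cauchy–Schwarz); no named facts.
-/

noncomputable section

namespace Summit.QuantumFields.QCD.Cruxes.WindowExtinction.KatoRadiusCollectiveDefects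

open scoped BigOperators Classical Matrix ComplexConjugate
open MeasureTheory Filter Matrix
open Literature.MathematicalPhysics.QuantumLattice Literature.MathematicalPhysics.QuantumFieldTheory
  Literature.Probability.LatticeModels
open Summit.QuantumFields.QCD.Theses.SpectralDefectExtinction
open Summit.QuantumFields.QCD.Theorems.ExtinctionBuildsQCD.Negative

/-- `Re⟨ψ, t•ψ⟩ = t‖ψ‖²` for real `t`. -/
theorem re_star_dotProduct_smul {L : ℕ} [NeZero L] (ψ : QuarkIdx L → ℂ) (t : ℝ) :
    (star ψ ⬝ᵥ ((t : ℂ) • ψ)).re = t * ∑ i, ‖ψ i‖ ^ 2 := by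
  rw [dotProduct_smul, smul_eq_mul, Complex.re_ofReal_mul, dotProduct, Complex.re_sum]
  congr 1
  refine Finset.sum_congr rfl fun i _ => ?_
  rw [Pi.star_apply]
  show ((starRingEnd ℂ) (ψ i) * ψ i).re = ‖ψ i‖ ^ 2
  rw [← Complex.normSq_eq_conj_mul_self, Complex.ofReal_re, Complex.normSq_eq_norm_sq]

/-- `(scalar μ) *ᵥ φ = μ • φ`. -/
theorem scalar_mulVec_eq_smul {L : ℕ} [NeZero L] (μ : ℂ) (φ : QuarkIdx L → ℂ) :
    Matrix.scalar (QuarkIdx L) μ *ᵥ φ = μ • φ := by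
  ext i
  simp [Matrix.scalar_apply, Matrix.mulVec_diagonal]

/-- **Clause (b) joins clause (a)** (the `Γ₅`-identity `{H_W(μ), Γ₅} = 2(W + μ)` read on an eigenvector):
if `Γ₅ D_W(U,μ,1) φ = e φ` then `Re⟨φ, D_W(U,0,1) φ⟩ = −μ‖φ‖² + e·Re⟨φ, Γ₅φ⟩ ≤ (−μ + |e|)‖φ‖²`
(`Γ₅² = 1`, `Γ₅` Hermitian hence isometric, Cauchy–Schwarz).  So a coercivity defect of the crux
(`μ = m_crit(k) + a_k m_f/Z_k`, `|e| < c a_k m_f/Z_k`) is a sub-edge vector with Wilson-energy budget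
`< −m_crit(k) − (1 − c) a_k m_f/Z_k`. -/
theorem re_form_massless_le_of_hermitian_eigen {L : ℕ} [NeZero L] (U : GaugeConfig 4 L SU3) (μ e : ℝ)
    (φ : QuarkIdx L → ℂ)
    (h : (spinorLift gammaFive * wilsonDirac (fundamentalRep (Fin 3)) U μ 1) *ᵥ φ = (e : ℂ) • φ) :
    (star φ ⬝ᵥ (wilsonDirac (fundamentalRep (Fin 3)) U 0 1 *ᵥ φ)).re ≤ (-μ + |e|) * ∑ i, ‖φ i‖ ^ 2 := by
  set Γ : Matrix (QuarkIdx L) (QuarkIdx L) ℂ := spinorLift gammaFive with hΓdef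
  have hΓ2 : Γ * Γ = 1 := spinorLift_gammaFive_mul_self
  have hΓH : Γᴴ = Γ :=
    Literature.Barriers.QuantumFields.WilsonDeterminant.conjTranspose_spinorLift_gammaFive
  -- `D_W(μ) φ = e • Γ φ`
  have h1 : wilsonDirac (fundamentalRep (Fin 3)) U μ 1 *ᵥ φ = (e : ℂ) • (Γ *ᵥ φ) := by
    have h' := congrArg (fun w => Γ *ᵥ w) h
    simp only [mulVec_mulVec, ← Matrix.mul_assoc, hΓ2, Matrix.one_mul, mulVec_smul] at h'
    exact h'
  -- `D_W(0) φ = e • Γ φ − μ • φ`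
  have h2 : wilsonDirac (fundamentalRep (Fin 3)) U 0 1 *ᵥ φ = (e : ℂ) • (Γ *ᵥ φ) - (μ : ℂ) • φ := by
    rw [wilsonDirac_mass_eq_add_scalar (fundamentalRep (Fin 3)) U μ 1, Matrix.add_mulVec,
      scalar_mulVec_eq_smul] at h1
    exact eq_sub_of_add_eq h1
  have h3 : (star φ ⬝ᵥ (wilsonDirac (fundamentalRep (Fin 3)) U 0 1 *ᵥ φ)).re =
      e * (star φ ⬝ᵥ (Γ *ᵥ φ)).re - μ * ∑ i, ‖φ i‖ ^ 2 := by
    rw [h2, dotProduct_sub, dotProduct_smul, dotProduct_smul, smul_eq_mul, smul_eq_mul, Complex.sub_re,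
      Complex.re_ofReal_mul, Complex.re_ofReal_mul, re_star_dotProduct_self]
  -- `|Re⟨φ, Γφ⟩| ≤ ‖φ‖²`
  have hiso : ∑ j, ‖(Γ *ᵥ φ) j‖ ^ 2 ≤ 1 ^ 2 * ∑ j, ‖φ j‖ ^ 2 := by
    have hG : Γᴴ * Γ = 1 := by rw [hΓH]; exact hΓ2
    rw [one_pow, one_mul,
      Summit.QuantumFields.QCD.Theorems.WindowExtinction.Negative.sum_norm_sq_mulVec_of_isometry hG φ]
  have hcs :=
    Summit.QuantumFields.QCD.Theorems.WindowExtinction.Negative.norm_star_dotProduct_le_of_sq_le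
      φ (Γ *ᵥ φ) zero_le_one hiso
  rw [one_mul] at hcs
  have hre : |(star φ ⬝ᵥ (Γ *ᵥ φ)).re| ≤ ∑ i, ‖φ i‖ ^ 2 :=
    (Complex.abs_re_le_norm _).trans hcs
  have hprod : e * (star φ ⬝ᵥ (Γ *ᵥ φ)).re ≤ |e| * ∑ i, ‖φ i‖ ^ 2 :=
    calc e * (star φ ⬝ᵥ (Γ *ᵥ φ)).re ≤ |e * (star φ ⬝ᵥ (Γ *ᵥ φ)).re| := le_abs_self _
      _ = |e| * |(star φ ⬝ᵥ (Γ *ᵥ φ)).re| := abs_mul _ _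
      _ ≤ |e| * ∑ i, ‖φ i‖ ^ 2 := mul_le_mul_of_nonneg_left hre (abs_nonneg _)
  rw [h3]
  linarith

/-- **Colon form of `re_form_massless_le_of_hermitian_eigen`** (registered anchor of this helper file): for every torus,
field, bare mass `μ`, eigenvalue `e` and eigenvector `φ` of `Γ₅ D_W(U,μ,1)`, `Re⟨φ, D_W(U,0,1)φ⟩ ≤ (−μ + |e|)‖φ‖²`. -/
theorem kato_re_form_massless_le_of_hermitian_eigen : ∀ (L : ℕ) [NeZero L] (U : GaugeConfig 4 L SU3) (μ e : ℝ) (φ : QuarkIdx L → ℂ), (spinorLift gammaFive * wilsonDirac (fundamentalRep (Fin 3)) U μ 1) *ᵥ φ = (e : ℂ) • φ → (star φ ⬝ᵥ (wilsonDirac (fundamentalRep (Fin 3)) U 0 1 *ᵥ φ)).re ≤ (-μ + |e|) * ∑ i, ‖φ i‖ ^ 2 :=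
  fun _ _ U μ e φ h => re_form_massless_le_of_hermitian_eigen U μ e φ h

end Summit.QuantumFields.QCD.Cruxes.WindowExtinction.KatoRadiusCollectiveDefects

end
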